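import Mathlib
import Literature.MathematicalPhysics.QuantumManyBody.BoseEinsteinCondensation
import Literature.Probability.Divergences.HellingerKullback
import Summits.AtomisticToContinuum.BoseEinsteinCondensation.Theorems.SoloBlindBhattacharyya

/-!
# Entropic Penrose–Onsager bound: relative entropy controls the weight of a one-particle mode

Solo seat `solo-AtomisticToContinuum-blind`, conjunct `BoseEinsteinCondensation`; sequel to
`SoloBlindBhattacharyya` (the affinity sandwich `BC² ≤ ⟨φ, γ_Ψ φ⟩/N ≤ BC`).

Let `m` be a measure, `p, q ≥ 0` two probability densities against `m`, `P = p·m`, `Q = q·m`.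
Combining the Hellinger–Kullback inequality `∫ (√(dQ/dP) - 1)² dP ≤ KL(Q ‖ P)` of
`Literature.Probability.Divergences` with the identity `∫ (√q - √p)² dm + 2 ∫ √(q p) dm = 2`
gives the affinity lower bound

* `two_sub_klDiv_le_two_mul_lintegral_sqrt` : `2 - KL(Q ‖ P) ≤ 2 · ∫ √(q p) dm`

(no absolute-continuity hypothesis: if `Q ≪̸ P` then `KL = ∞` and the bound is empty).
Specialised to an `N`-body amplitude `Φ ≥ 0` (`p = Φ²` in the coordinates `(x, Y)`,
`x` the distinguished particle) and its *one-particle resampling* `q(x, Y) = g(x)² · P̂(Y)`,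
`P̂(Y) = ∫ Φ(x :: Y)² dx`, and combined with `bhattacharyya_sq_le_maxOccupation`, this is the
**entropic Penrose–Onsager criterion**

* `mul_one_sub_klDiv_sq_le_maxOccupation` :
  `(n+1) · (1 - KL(Q ‖ P)/2)² ≤ maxOccupation (n+1) Φ`,

i.e. a bound on the relative entropy of the resampled law with respect to the Born law `|Φ|²`
that is uniform in the particle number forces macroscopic occupation of the mode `g`.
-/

open MeasureTheory InformationTheory
open scoped ENNReal

namespace Summit.AtomisticToContinuum.BoseEinsteinCondensation.Theorems

section Abstract

variable {γ : Type*} [MeasurableSpace γ]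

/-- Real identity behind the Hellinger decomposition: for `s > 0`, `t ≥ 0`,
`s² (t/s - 1)² + 2 t s = t² + s²`. -/
theorem sq_mul_div_sub_one_sq_add (s t : ℝ) (hs : s ≠ 0) :
    s ^ 2 * (t / s - 1) ^ 2 + 2 * (t * s) = t ^ 2 + s ^ 2 := by
  field_simp
  ring

/-- Pointwise identity `p (√(q/p) - 1)² + 2 √(q p) = q + p` in `ℝ≥0∞`, for finite `p, q` with
`p = 0 → q = 0`. -/
theorem mul_ofReal_sqrt_sub_one_sq_add {p q : ℝ≥0∞} (hp : p ≠ ∞) (hq : q ≠ ∞)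
    (hpq : p = 0 → q = 0) :
    p * ENNReal.ofReal ((Real.sqrt ((q / p).toReal) - 1) ^ 2) + 2 * (q * p) ^ (1 / 2 : ℝ) =
      q + p := by
  by_cases hp0 : p = 0
  · have hq0 : q = 0 := hpq hp0
    subst hp0; subst hq0
    simp
  -- write `p = ofReal p'`, `q = ofReal q'`
  set p' := p.toReal with hp'
  set q' := q.toReal with hq'
  have hp'0 : 0 < p' := ENNReal.toReal_pos hp0 hp
  have hq'0 : 0 ≤ q' := ENNReal.toReal_nonneg
  have hpe : p = ENNReal.ofReal p' := (ENNReal.ofReal_toReal hp).symm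
  have hqe : q = ENNReal.ofReal q' := (ENNReal.ofReal_toReal hq).symm
  have hdiv : (q / p).toReal = q' / p' := by rw [ENNReal.toReal_div]
  rw [hdiv, hpe, hqe, ← ENNReal.ofReal_mul hq'0,
    ENNReal.ofReal_rpow_of_nonneg (mul_nonneg hq'0 hp'0.le) (by norm_num : (0 : ℝ) ≤ 1 / 2),
    ← Real.sqrt_eq_rpow, ← ENNReal.ofReal_mul hp'0.le, ← ENNReal.ofReal_ofNat,
    ← ENNReal.ofReal_mul (by norm_num : (0 : ℝ) ≤ 2),
    ← ENNReal.ofReal_add (mul_nonneg hp'0.le (sq_nonneg _))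
      (mul_nonneg (by norm_num) (Real.sqrt_nonneg _)),
    ← ENNReal.ofReal_add hq'0 hp'0.le]
  congr 1
  rw [Real.sqrt_div hq'0, Real.sqrt_mul hq'0]
  have key := sq_mul_div_sub_one_sq_add (Real.sqrt p') (Real.sqrt q')
    (Real.sqrt_ne_zero'.mpr hp'0)
  rw [Real.sq_sqrt hp'0.le, Real.sq_sqrt hq'0] at key
  linarith [key]

/-- **Affinity is bounded below by relative entropy**: for probability densities `p, q`
against `m`, `2 - KL(q·m ‖ p·m) ≤ 2 ∫ √(q p) dm`, i.e. `BC ≥ 1 - KL/2`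
(from `H² ≤ KL`, `Literature.Probability.Divergences.lintegral_sqrt_rnDeriv_sub_one_sq_le_klDiv`,
and `H² = 2 - 2·BC`). -/
theorem two_sub_klDiv_le_two_mul_lintegral_sqrt (m : Measure γ) {p q : γ → ℝ≥0∞}
    (hp : Measurable p) (hq : Measurable q) (hp1 : ∫⁻ x, p x ∂m = 1) (hq1 : ∫⁻ x, q x ∂m = 1) :
    2 - klDiv (m.withDensity q) (m.withDensity p) ≤ 2 * ∫⁻ x, (q x * p x) ^ (1 / 2 : ℝ) ∂m := by
  set P := m.withDensity p with hP
  set Q := m.withDensity q with hQ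
  by_cases hac : Q ≪ P
  swap
  · simp [klDiv_of_not_ac hac]
  haveI : IsFiniteMeasure P := isFiniteMeasure_withDensity (by simp [hp1])
  haveI : IsFiniteMeasure Q := isFiniteMeasure_withDensity (by simp [hq1])
  -- a.e. finiteness
  have hp_top : ∀ᵐ x ∂m, p x < ∞ := ae_lt_top hp (by simp [hp1])
  have hq_top : ∀ᵐ x ∂m, q x < ∞ := ae_lt_top hq (by simp [hq1])
  -- `q = 0` a.e. on `{p = 0}` (from `Q ≪ P`)
  have hs : MeasurableSet {x | p x = 0} := hp (measurableSet_singleton 0)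
  have hPs : P {x | p x = 0} = 0 := by
    rw [hP, withDensity_apply _ hs]
    have : ∫⁻ x in {x | p x = 0}, p x ∂m = ∫⁻ x in {x | p x = 0}, 0 ∂m :=
      setLIntegral_congr_fun hs (fun x hx => hx)
    simpa using this
  have hQs : ∫⁻ x in {x | p x = 0}, q x ∂m = 0 := by
    have := hac hPs
    rwa [hQ, withDensity_apply _ hs] at this
  have hpq : ∀ᵐ x ∂m, p x = 0 → q x = 0 := by
    have h1 : q =ᵐ[m.restrict {x | p x = 0}] 0 :=
      (lintegral_eq_zero_iff' hq.aemeasurable).mp hQs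
    exact (ae_restrict_iff' hs).mp h1
  -- `Q = P.withDensity (q/p)`
  have hqp : Measurable (q / p) := hq.div hp
  have h_ae : q =ᵐ[m] p * (q / p) := by
    filter_upwards [hp_top, hpq] with x hxt hx0
    simp only [Pi.mul_apply, Pi.div_apply]
    by_cases h0 : p x = 0
    · simp [h0, hx0 h0]
    · rw [ENNReal.mul_div_cancel h0 hxt.ne]
  have hQeq : Q = P.withDensity (q / p) := by
    rw [hQ, hP, ← withDensity_mul _ hp hqp]
    exact withDensity_congr_ae h_ae
  have hrn : ∀ᵐ x ∂m, p x ≠ 0 → Q.rnDeriv P x = q x / p x := by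
    have h1 : Q.rnDeriv P =ᵐ[P] (q / p) := by
      rw [hQeq]
      exact Measure.rnDeriv_withDensity _ hqp
    rw [hP] at h1
    exact (ae_withDensity_iff hp).mp h1
  -- Hellinger ≤ KL, rewritten against `m`
  have hT := Literature.Probability.Divergences.lintegral_sqrt_rnDeriv_sub_one_sq_le_klDiv Q P hac
  have hF : Measurable fun x =>
      ENNReal.ofReal ((Real.sqrt ((Q.rnDeriv P x).toReal) - 1) ^ 2) :=
    (((Measure.measurable_rnDeriv _ _).ennreal_toReal.sqrt.sub measurable_const).pow_const
      2).ennreal_ofReal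
  have hF' : Measurable fun x => ENNReal.ofReal ((Real.sqrt ((q x / p x).toReal) - 1) ^ 2) :=
    (((hq.div hp).ennreal_toReal.sqrt.sub measurable_const).pow_const 2).ennreal_ofReal
  have hH : ∫⁻ x, ENNReal.ofReal ((Real.sqrt ((Q.rnDeriv P x).toReal) - 1) ^ 2) ∂P =
      ∫⁻ x, p x * ENNReal.ofReal ((Real.sqrt ((q x / p x).toReal) - 1) ^ 2) ∂m := by
    rw [hP, lintegral_withDensity_eq_lintegral_mul _ hp hF]
    refine lintegral_congr_ae ?_
    filter_upwards [hrn] with x hx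
    simp only [Pi.mul_apply]
    by_cases h0 : p x = 0
    · simp [h0]
    · rw [hx h0]
  -- the identity `∫ p (√(q/p)-1)² + 2 ∫ √(qp) = 2`
  have hid : ∫⁻ x, p x * ENNReal.ofReal ((Real.sqrt ((q x / p x).toReal) - 1) ^ 2) ∂m +
      2 * ∫⁻ x, (q x * p x) ^ (1 / 2 : ℝ) ∂m = 2 := by
    have hm1 : Measurable fun x => (q x * p x) ^ (1 / 2 : ℝ) := (hq.mul hp).pow_const _
    have hm2 : Measurable fun x =>
        p x * ENNReal.ofReal ((Real.sqrt ((q x / p x).toReal) - 1) ^ 2) := hp.mul hF'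
    rw [← lintegral_const_mul 2 hm1, ← lintegral_add_left hm2]
    have h2' : ∫⁻ x, q x + p x ∂m = 2 := by
      rw [lintegral_add_left hq, hq1, hp1]; norm_num
    refine Eq.trans (lintegral_congr_ae ?_) h2'
    filter_upwards [hp_top, hq_top, hpq] with x hxp hxq hx0
    exact mul_ofReal_sqrt_sub_one_sq_add hxp.ne hxq.ne hx0
  -- conclude
  have h2 : (2 : ℝ≥0∞) ≤ 2 * ∫⁻ x, (q x * p x) ^ (1 / 2 : ℝ) ∂m + klDiv Q P := by
    calc (2 : ℝ≥0∞) = ∫⁻ x, p x * ENNReal.ofReal ((Real.sqrt ((q x / p x).toReal) - 1) ^ 2) ∂m +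
          2 * ∫⁻ x, (q x * p x) ^ (1 / 2 : ℝ) ∂m := hid.symm
      _ ≤ klDiv Q P + 2 * ∫⁻ x, (q x * p x) ^ (1 / 2 : ℝ) ∂m := by
          rw [← hH]; exact add_le_add hT le_rfl
      _ = _ := add_comm _ _
  exact tsub_le_iff_right.mpr h2

/-- Corollary in the `1 - KL/2 ≤ BC` form. -/
theorem one_sub_klDiv_div_two_le_lintegral_sqrt (m : Measure γ) {p q : γ → ℝ≥0∞}
    (hp : Measurable p) (hq : Measurable q) (hp1 : ∫⁻ x, p x ∂m = 1) (hq1 : ∫⁻ x, q x ∂m = 1) :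
    1 - klDiv (m.withDensity q) (m.withDensity p) / 2 ≤ ∫⁻ x, (q x * p x) ^ (1 / 2 : ℝ) ∂m := by
  have h := two_sub_klDiv_le_two_mul_lintegral_sqrt m hp hq hp1 hq1
  have h2 : (2 : ℝ≥0∞) * (1 - klDiv (m.withDensity q) (m.withDensity p) / 2) =
      2 - klDiv (m.withDensity q) (m.withDensity p) := by
    rw [ENNReal.mul_sub (fun _ _ => by norm_num), mul_one,
      ENNReal.mul_div_cancel (by norm_num) (by norm_num)]
  rw [← h2] at h
  exact (ENNReal.mul_le_mul_iff_right (by norm_num) (by norm_num)).mp h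

end Abstract

section BoseGas

open Literature.MathematicalPhysics.QuantumManyBody.BoseGas

/-- **Entropic Penrose–Onsager criterion.** Let `Φ ≥ 0` be an `(n+1)`-body amplitude,
normalised, and `g ≥ 0` a normalised one-particle mode. In the coordinates `(x, Y)`
(`x` the distinguished particle, `Y` the other `n`), let `P` be the Born law (density
`Φ(x :: Y)²`) and `Q` its one-particle resampling (density `g(x)² · ∫ Φ(x' :: Y)² dx'`).
Then `(n+1) · (1 - KL(Q ‖ P)/2)² ≤ maxOccupation (n+1) Φ`: relative entropy of the resampled
law w.r.t. the Born law that stays bounded (by `< 2`) uniformly in the particle number forces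
macroscopic occupation of the mode `g`. -/
theorem mul_one_sub_klDiv_sq_le_maxOccupation {n : ℕ} {g : Space → ℝ} {Φ : Config (n + 1) → ℝ}
    (hg0 : 0 ≤ g) (hΦ0 : 0 ≤ Φ) (hgm : Measurable g) (hΦm : Measurable Φ)
    (hint : ∀ Y : Config n, Integrable (fun x => g x * Φ (Matrix.vecCons x Y)))
    (hg1 : ∫⁻ x, ENNReal.ofReal (g x) ^ 2 = 1)
    (hΦ1 : ∫⁻ Y : Config n, ∫⁻ x, ENNReal.ofReal (Φ (Matrix.vecCons x Y)) ^ 2 = 1) :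
    (n + 1 : ℝ≥0∞) *
        (1 - klDiv
            (((volume : Measure Space).prod (volume : Measure (Config n))).withDensity
              fun z => ENNReal.ofReal (g z.1) ^ 2 *
                ∫⁻ y, ENNReal.ofReal (Φ (Matrix.vecCons y z.2)) ^ 2)
            (((volume : Measure Space).prod (volume : Measure (Config n))).withDensity
              fun z => ENNReal.ofReal (Φ (Matrix.vecCons z.1 z.2)) ^ 2) / 2) ^ 2 ≤
      maxOccupation (n + 1) (fun X => (Φ X : ℂ)) := by
  -- the two densities on `Space × Config n`
  set Ψ : Space → Config n → ℝ≥0∞ := fun y b => ENNReal.ofReal (Φ (Matrix.vecCons y b)) with hΨ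
  set φ : Space → ℝ≥0∞ := fun y => ENNReal.ofReal (g y) with hφ
  have hΨm : Measurable (Function.uncurry Ψ) :=
    (hΦm.comp measurable_vecCons).ennreal_ofReal
  have hφm : Measurable φ := hgm.ennreal_ofReal
  have hpm : Measurable fun z : Space × Config n => Ψ z.1 z.2 ^ 2 := hΨm.pow_const 2
  have hPhat : Measurable fun b : Config n => ∫⁻ y, Ψ y b ^ 2 := hpm.lintegral_prod_left'
  have hqm : Measurable fun z : Space × Config n => φ z.1 ^ 2 * ∫⁻ y, Ψ y z.2 ^ 2 :=
    ((hφm.comp measurable_fst).pow_const 2).mul (hPhat.comp measurable_snd)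
  have hp1 : ∫⁻ z, Ψ z.1 z.2 ^ 2 ∂((volume : Measure Space).prod (volume : Measure (Config n)))
      = 1 := by
    rw [lintegral_prod_symm _ hpm.aemeasurable]
    exact hΦ1
  have hq1 : ∫⁻ z, φ z.1 ^ 2 * (∫⁻ y, Ψ y z.2 ^ 2)
      ∂((volume : Measure Space).prod (volume : Measure (Config n))) = 1 := by
    rw [lintegral_prod _ hqm.aemeasurable]
    have hPhat1 : ∫⁻ b : Config n, ∫⁻ y, Ψ y b ^ 2 = 1 := hΦ1
    have h1 : ∀ x : Space, ∫⁻ b : Config n, φ x ^ 2 * (∫⁻ y, Ψ y b ^ 2) = φ x ^ 2 := by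
      intro x
      rw [lintegral_const_mul _ hPhat, hPhat1, mul_one]
    calc _ = ∫⁻ x, φ x ^ 2 := lintegral_congr fun x => h1 x
      _ = 1 := hg1
  have hBC := one_sub_klDiv_div_two_le_lintegral_sqrt
    ((volume : Measure Space).prod (volume : Measure (Config n))) hpm hqm hp1 hq1
  -- identify the product-space affinity with the iterated one
  have hid := lintegral_sqrt_densities_eq (volume : Measure Space) (volume : Measure (Config n))
    hΨm hφm
  have hBC' : 1 - klDiv
      (((volume : Measure Space).prod (volume : Measure (Config n))).withDensity
        fun z => φ z.1 ^ 2 * ∫⁻ y, Ψ y z.2 ^ 2)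
      (((volume : Measure Space).prod (volume : Measure (Config n))).withDensity
        fun z => Ψ z.1 z.2 ^ 2) / 2 ≤
      ∫⁻ b, (∫⁻ y, φ y * Ψ y b) * (∫⁻ y, Ψ y b ^ 2) ^ (1 / 2 : ℝ) := by
    rw [← hid]
    refine hBC.trans (le_of_eq (lintegral_congr fun z => ?_))
    ring_nf
  have hsand := bhattacharyya_sq_le_maxOccupation hg0 hΦ0 hgm hΦm hint hg1 hΦ1
  refine le_trans ?_ hsand
  exact mul_le_mul' le_rfl (pow_le_pow_left' hBC' 2)

end BoseGas

end Summit.AtomisticToContinuum.BoseEinsteinCondensation.Theorems
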